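import Summits.HodgeConjecture.CorCM.HCCMIffWeilFaceLines
import Summits.HodgeConjecture.CorCM.Milne2020OfRiemann
import Summits.HodgeConjecture.HodgeConjecture.Theses.RankFourFaces
import Literature.AlgebraicGeometry.Milne1999.CMTypeSubquotients
import HarnessLib

/-!
# COR-CM (cell `pub-hodgecm2`): the route item `RankFourFaces.RankFourWeilClasses` implies `HC_CM` in the kernel —
# rank-four Weil classes of Galois CM field polynomials of degree `≥ 6` suffice, NO record

HONEST FRAMING (cell pub-hodgecm2 / COR-CM, seat b24 gen 21, count-neutral lane RANK4-HCCM; theorems only, no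
definition, no named fact; no case of the Hodge conjecture is proved).  The route `RankFourFaces`
(`Summits/HodgeConjecture/HodgeConjecture/Theses/RankFourFaces.lean`) carries the SUPPORT item
`RankFourWeilClasses` (stmt-HodgeConjecture-16268: for every CM field `E = ℚ[T]/(P)` of degree `2g ≥ 4` acting with
`E`-rank `4` on an abelian `4g`-fold `(A, φ)`, `P(φ) = 0`, every rational `(2,2)` class of the complexified Weil space
`W_E(A) ⊗ ℂ = ⨆_{P(ρ)=0} pullbackEigenclasses A φ 4 ((x,y) ↦ (x + yρ)⁴)` is algebraic) and the TARGET
`CMAbelianHodge = HC_CM` (stmt-HodgeConjecture-3052).  In the tree so far the arrow «rank four ⟹ `HC_CM`» is CONDITIONAL: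
`Ring2AbelianAllFrameRankFour.HC_CM_of_andre_of_hazama_of_markmanFourfolds_of_rankFourWeilClasses` (André's record,
Hazama 2003, Markman's fourfolds), `HodgeTheory.cmHodgeHypothesisAt_of_rankFourWeil` (André, Hazama),
`Milne2020.hc_cm_of_rankFourWeilClassesField_galois_of_hazama` (Hazama).  Here it is made UNCONDITIONAL, and sharpened:

* `hc_cm_of_forall_face_weilClassesField` — the FACE form: if for every Galois CM field `F` with `6 ≤ [F:ℚ]`, every
  rank-four face `f` of `F` and every integer `a₀ ∈ 𝓞_F` separating the complex embeddings, the rational `(2,2)`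
  classes of `weilClassesField (⨁_j A_{(F, f.corner j)}) (act a₀) (minpoly_ℤ a₀) 4` (Moonen–Zarhin's `W_F ⊗ ℂ` on the
  record's carrier, `HodgeTheory/WeilClassesMoonenZarhinCriterion`) are algebraic, then `HC_CM`.  Route: the face
  `F`-Weil-line classes `weilLineClasses` lie in `weilClassesField` (`Milne2020.weilLineClasses_le_weilClassesField`, seat
  lit-milne), their algebraicity gives `U.WeilFaceAlgebraic F f` on the model universe
  (`Model.weilFaceAlgebraic_of_weilLineClasses`, seat p2), i.e. `U.W_RK4`, and `U.W_RK4 ⟹ HC_CM`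
  (`SliceExhaustion.hc_cm_of_w_rk4`, seat b24: [QW8] face reduction on the model + exhaustion by Galois slices);
* `hc_cm_iff_forall_face_weilClassesField` — and conversely (the corner products are CM abelian varieties, on which
  `HC_CM` makes the rational `(2,2)` classes algebraic): **`HC_CM` IS the algebraicity of the rational `(2,2)` classes of
  `W_F ⊗ ℂ` on the `2[F:ℚ]`-dimensional corner products of the rank-four faces of the Galois CM fields of degree `≥ 6`**;
* `hc_cm_of_rankFourWeilClassesField_galois_six_le` — the record-shaped form: lit-milne's
  `hc_cm_of_rankFourWeilClassesField_galois_of_hazama` WITHOUT Hazama's record and with the Galois CM field polynomials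
  restricted to degree `e ≥ 6` (imaginary quadratic and quartic fields never occur as targets);
* **`cmAbelianHodge_of_rankFourWeilClasses : RankFourWeilClasses → CMAbelianHodge`** — the route's support item implies
  its target (only its instances `g ≥ 3`, `P` a Galois CM field polynomial, `A` a CM corner product are used; Markman's
  fourfold theorem is not needed); `faceReduction_of_rankFourWeilClasses` — hence the crux `FaceReduction`
  (stmt-HodgeConjecture-16266, `RankFourWeilTransport → CMAbelianHodge`) with its hypothesis idle, and
  `faceReduction_iff_transport_imp_faceWeilClasses` — the crux IS the statement that the transport delivers the
  rational `(2,2)` classes of `W_F ⊗ ℂ` on the CM corner products of faces (what stub A + glue of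
  `Cruxes/FaceReduction/Lines/birth.lean` must produce, and no more).

The converse `HC_CM → RankFourWeilClasses` is NOT claimed (the item's carriers `(A, φ)` include abelian varieties of
Weil type that are not of CM type).

References: [Andre1992HodgeCM] Y. André, Progr. Math. 102 (1992) 1–7, Théorème; [Milne2020HodgeClassesAV] J. S. Milne,
*Hodge classes on abelian varieties* (2020) §2–§3, Thm. 1; [MoonenZarhin1998WeilClasses] B. Moonen, Yu. Zarhin,
J. reine angew. Math. 496 (1998) §1; [Pohlmann1968] H. Pohlmann, Ann. Math. 88 (1968) Thm. 1; [Deligne1982HodgeCycles]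
P. Deligne, LNM 900 (1982) §4–§5; [Markman2025SurveySecant] E. Markman, arXiv:2509.23403, Thm. 1.4 and §12;
rfwf v3 Thm 1.3 / [QW8] Thm 2.5 (`CorCM/Geometry/Statements.lean`).
-/

noncomputable section

open CategoryTheory CategoryTheory.Limits NumberField Polynomial
open Literature.AlgebraicGeometry Literature.AlgebraicGeometry.Motives Literature.AlgebraicGeometry.HodgeTheory
open Literature.AlgebraicGeometry.ComplexMultiplication Literature.AlgebraicGeometry.Milne1999
open Literature.NumberTheory.Automorphic
open Literature.NumberTheory.Automorphic.PicardCM (BallQuotientUniformisedDatum CMAbelianVarietyRealised)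
open Summit.HodgeConjecture.CorCM.Domination
open Summit.HodgeConjecture.CorCM.Model
open Summit.HodgeConjecture.CorCM.AndreProductForm
open Summit.HodgeConjecture.CorCM.Milne2020
open Summit.HodgeConjecture.CorCM.SliceExhaustion
open Summit.HodgeConjecture.HodgeConjecture.Theses.RankFourFaces (CMAbelianHodge RankFourWeilClasses
  RankFourWeilTransport FaceReduction)

namespace Summit.HodgeConjecture.CorCM.RankFourWeil

/-! ## §1 The face form: rational `(2,2)` classes of `W_F ⊗ ℂ` on the corner products ⟹ `HC_CM` -/

/-- **`HC_CM` from the rank-four Weil classes of the CM corner products of faces** (any instance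
`U = Model.universeOf hHD hI hU h₃` of the model universe): if for every Galois CM field `F` with `6 ≤ [F:ℚ]`, every
rank-four face `f` and every separating integer `a₀ ∈ 𝓞_F`, the rational `(2,2)` classes of
`weilClassesField (⨁_j A_{(F, f.corner j)}) (act a₀) (minpoly_ℤ a₀) 4` are algebraic, then the Hodge conjecture holds for
every complex abelian variety of CM type.  The face `F`-Weil-line classes lie in that space
(`Milne2020.weilLineClasses_le_weilClassesField`), so `U.WeilFaceAlgebraic F f` (`Model.weilFaceAlgebraic_of_weilLineClasses`)
for all faces, i.e. `U.W_RK4`, whence `HC_CM` (`SliceExhaustion.hc_cm_of_w_rk4`).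
[cite: MoonenZarhin1998WeilClasses, §1] [cite: Milne2020HodgeClassesAV, §2–§3, Thm. 1] [cite: Pohlmann1968, Thm. 1] -/
theorem hc_cm_of_forall_face_weilClassesField (hHD : exists_isReal_hodgeModel)
    (hI : hodgePQ_independent_of_hodgeModel) (hU : BallQuotientUniformisedDatum) (h₃ : CMAbelianVarietyRealised)
    (h : ∀ (F : CMField), IsGalois ℚ F → 6 ≤ Module.finrank ℚ F → ∀ (f : Face F) (a₀ : 𝓞 F),
      (Function.Injective fun σ : (F : Type) →+* ℂ => σ (a₀ : F)) →
      ∀ w ∈ weilClassesField (⨁ cornerAV h₃ F f.corner)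
          (diagHom F (cornerAV h₃ F f.corner) (cornerAct h₃ F f.corner) a₀) (minpoly ℤ a₀) (2 * 2),
        IsRationalClass w →
        IsOfHodgeType (⨁ cornerAV h₃ F f.corner).dim (⨁ cornerAV h₃ F f.corner).X (2 * 2) 2 2 w →
        w ∈ algebraicClasses (⨁ cornerAV h₃ F f.corner).X 2) :
    HC_CM := by
  refine hc_cm_of_w_rk4 hHD hI hU h₃ ?_
  intro F hG h6 f
  obtain ⟨a₀, hsep⟩ := exists_integer_separating (F : Type)
  exact weilFaceAlgebraic_of_weilLineClasses hHD hI hU h₃ F f fun t htQ htH htW =>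
    h F hG h6 f a₀ hsep t
      (weilLineClasses_le_weilClassesField F (cornerAV h₃ F f.corner) (cornerAct h₃ F f.corner) a₀ (2 * 2) htW)
      htQ htH

/-- `2 dim (⨁_j A_{(F, Φ_j)}) = 4 [F:ℚ]` for the four corner realisations (eigenbases of `H¹`). [folklore] -/
theorem two_mul_dim_biproduct_cornerAV (h₃ : CMAbelianVarietyRealised) (F : CMField) (Φ : Fin 4 → CMType F) :
    2 * (⨁ cornerAV h₃ F Φ).dim = 4 * Module.finrank ℚ F := by
  have h := two_mul_dim_biproduct (cornerAV h₃ F Φ)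
    fun j => (exists_eigenbasis (cornerAV_isCMTypeRealisation h₃ F Φ j)).choose
  rwa [Fintype.card_fin, NumberField.Embeddings.card] at h

/-- `dim (⨁_j A_{(F, Φ_j)}) = 2 [F:ℚ]`. [folklore] -/
theorem dim_biproduct_cornerAV (h₃ : CMAbelianVarietyRealised) (F : CMField) (Φ : Fin 4 → CMType F) :
    (⨁ cornerAV h₃ F Φ).dim = 2 * Module.finrank ℚ F := by
  have h := two_mul_dim_biproduct_cornerAV h₃ F Φ
  omega

/-- The biproduct of the four corner realisations is a complex abelian variety of CM type (it is isomorphic to the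
left-nested product `cmProdAV F h₃ 3 Φ`, `Domination.nonempty_cmProdAV_iso_biproduct`, which is of CM type,
`SliceExhaustion.isOfCMType_cmProdAV`; CM type passes along split epimorphisms, `IsOfCMType.of_comp_eq_id`).
[cite: Milne1999, §2 p. 54] -/
theorem isOfCMType_biproduct_cornerAV (h₃ : CMAbelianVarietyRealised) (F : CMField) (Φ : Fin 4 → CMType F) :
    IsOfCMType (⨁ cornerAV h₃ F Φ) := by
  obtain ⟨e⟩ := nonempty_cmProdAV_iso_biproduct (F : Type) h₃ 3 Φ
  exact IsOfCMType.of_comp_eq_id (isOfCMType_cmProdAV h₃ 3 Φ) e.inv e.hom e.inv_hom_id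

/-- **`HC_CM` makes the rational `(2,2)` classes on the corner products algebraic** (the easy converse: the corner
product is a CM abelian variety, `isOfCMType_biproduct_cornerAV`). [cite: Milne1999, §7 p. 72] -/
theorem mem_algebraicClasses_biproduct_cornerAV_of_hc_cm (h : HC_CM) (h₃ : CMAbelianVarietyRealised) (F : CMField)
    (Φ : Fin 4 → CMType F) (w : complexBetti (⨁ cornerAV h₃ F Φ).X (2 * 2)) (hwQ : IsRationalClass w)
    (hwH : IsOfHodgeType (⨁ cornerAV h₃ F Φ).dim (⨁ cornerAV h₃ F Φ).X (2 * 2) 2 2 w) :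
    w ∈ algebraicClasses (⨁ cornerAV h₃ F Φ).X 2 :=
  (h _ AbelianVariety.isSmoothProjective_holds (isOfCMType_biproduct_cornerAV h₃ F Φ)).2 2 w hwQ hwH

/-- **`HC_CM` ⟺ the rational `(2,2)` classes of `W_F ⊗ ℂ` on the CM corner products of the rank-four faces of the Galois
CM fields of degree `≥ 6` are algebraic** (at any instance of the model universe; the `W_F ⊗ ℂ`-membership hypothesis is
simply dropped in the forward direction).  Neither side is asserted.
[cite: MoonenZarhin1998WeilClasses, §1] [cite: Pohlmann1968, Thm. 1] [cite: Milne2020HodgeClassesAV, Thm. 1] -/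
theorem hc_cm_iff_forall_face_weilClassesField (hHD : exists_isReal_hodgeModel)
    (hI : hodgePQ_independent_of_hodgeModel) (hU : BallQuotientUniformisedDatum) (h₃ : CMAbelianVarietyRealised) :
    HC_CM ↔ ∀ (F : CMField), IsGalois ℚ F → 6 ≤ Module.finrank ℚ F → ∀ (f : Face F) (a₀ : 𝓞 F),
      (Function.Injective fun σ : (F : Type) →+* ℂ => σ (a₀ : F)) →
      ∀ w ∈ weilClassesField (⨁ cornerAV h₃ F f.corner)
          (diagHom F (cornerAV h₃ F f.corner) (cornerAct h₃ F f.corner) a₀) (minpoly ℤ a₀) (2 * 2),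
        IsRationalClass w →
        IsOfHodgeType (⨁ cornerAV h₃ F f.corner).dim (⨁ cornerAV h₃ F f.corner).X (2 * 2) 2 2 w →
        w ∈ algebraicClasses (⨁ cornerAV h₃ F f.corner).X 2 :=
  ⟨fun h F _ _ f _ _ w _ hwQ hwH => mem_algebraicClasses_biproduct_cornerAV_of_hc_cm h h₃ F f.corner w hwQ hwH,
    hc_cm_of_forall_face_weilClassesField hHD hI hU h₃⟩

/-- The same equivalence with all four data of the model universe DISCHARGED by the tree theorems
`exists_isReal_hodgeModel_holds`, `hodgePQ_independent_of_hodgeModel_holds`, `BallQuotient.ballQuotientUniformisedDatum_holds`,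
`cmAbelianVarietyRealised_holds` — no hypothesis. [cite: MoonenZarhin1998WeilClasses, §1] [cite: Pohlmann1968, Thm. 1] -/
theorem hc_cm_iff_forall_face_weilClassesField_of_record :
    HC_CM ↔ ∀ (F : CMField), IsGalois ℚ F → 6 ≤ Module.finrank ℚ F → ∀ (f : Face F) (a₀ : 𝓞 F),
      (Function.Injective fun σ : (F : Type) →+* ℂ => σ (a₀ : F)) →
      ∀ w ∈ weilClassesField (⨁ cornerAV cmAbelianVarietyRealised_holds F f.corner)
          (diagHom F (cornerAV cmAbelianVarietyRealised_holds F f.corner)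
            (cornerAct cmAbelianVarietyRealised_holds F f.corner) a₀) (minpoly ℤ a₀) (2 * 2),
        IsRationalClass w →
        IsOfHodgeType (⨁ cornerAV cmAbelianVarietyRealised_holds F f.corner).dim
          (⨁ cornerAV cmAbelianVarietyRealised_holds F f.corner).X (2 * 2) 2 2 w →
        w ∈ algebraicClasses (⨁ cornerAV cmAbelianVarietyRealised_holds F f.corner).X 2 :=
  hc_cm_iff_forall_face_weilClassesField exists_isReal_hodgeModel_holds hodgePQ_independent_of_hodgeModel_holds
    BallQuotient.ballQuotientUniformisedDatum_holds cmAbelianVarietyRealised_holds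

/-! ## §2 The record-shaped form: Galois CM field polynomials of degree `≥ 6`, rank four, no Hazama -/

/-- **`HC_CM` from the `F`-rank-FOUR Weil classes of the Galois CM field polynomials of degree `≥ 6` — NO record.**
If for every Galois CM field polynomial `P` of degree `e ≥ 6` (`HodgeTheory.IsGaloisCMFieldPoly P e`), every complex
abelian variety `B` with `ψ : B ⟶ B`, `P(ψ) = 0`, `4e = 2 dim B`, the rational `(2,2)` classes of
`weilClassesField B ψ P 4` are algebraic, then `HC_CM`.  This is lit-milne's
`Milne2020.hc_cm_of_rankFourWeilClassesField_galois_of_hazama` with Hazama's codimension-two record REMOVED (the passage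
from codimension two to all codimensions is the cell's face reduction [QW8] Thm 2.5 on the model, inside
`SliceExhaustion.hc_cm_of_w_rk4`) and the fields restricted to degree `≥ 6`: the hypothesis is used only at
`P = minpoly_ℤ(a₀)` for a separating integer `a₀` of a Galois CM field `F` of degree `≥ 6`
(`Milne2020.isGaloisCMFieldPoly_minpoly`), `B = ⨁_j A_{(F, f.corner j)}`, `ψ = act(a₀)` (`Milne2020.eval₂_diagHom_minpoly`).
[cite: Milne2020HodgeClassesAV, §3 Thm. 1] [cite: MoonenZarhin1998WeilClasses, §1] [cite: Pohlmann1968, Thm. 1] -/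
theorem hc_cm_of_rankFourWeilClassesField_galois_six_le
    (h₄ : ∀ (P : Polynomial ℤ) (e : ℕ), IsGaloisCMFieldPoly P e → 6 ≤ e →
      ∀ (B : AbelianVariety ℂ) (ψ : B ⟶ B),
        Polynomial.eval₂ (Int.castRingHom (CategoryTheory.End B)) (ψ : CategoryTheory.End B) P = 0 →
        e * (2 * 2) = 2 * B.dim →
          ∀ w ∈ weilClassesField B ψ P (2 * 2), IsRationalClass w →
            IsOfHodgeType B.dim B.X (2 * 2) 2 2 w → w ∈ algebraicClasses B.X 2) :
    HC_CM := by
  refine hc_cm_of_forall_face_weilClassesField exists_isReal_hodgeModel_holds hodgePQ_independent_of_hodgeModel_holds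
    BallQuotient.ballQuotientUniformisedDatum_holds cmAbelianVarietyRealised_holds ?_
  intro F hG h6 f a₀ hsep w hw hwQ hwH
  haveI : IsGalois ℚ (F : Type) := hG
  refine h₄ (minpoly ℤ a₀) (Module.finrank ℚ F) (isGaloisCMFieldPoly_minpoly F a₀ hsep) h6 _ _
    (eval₂_diagHom_minpoly F _ _ a₀) ?_ w hw hwQ hwH
  have hd := two_mul_dim_biproduct_cornerAV cmAbelianVarietyRealised_holds F f.corner
  omega

/-! ## §3 The route item: `RankFourWeilClasses ⟹ CMAbelianHodge`, and what `FaceReduction` needs -/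

/-- **The route item `RankFourFaces.RankFourWeilClasses` (stmt-HodgeConjecture-16268) implies the route's target
`RankFourFaces.CMAbelianHodge` (stmt-HodgeConjecture-3052, `= HC_CM`), unconditionally.**  Used instances only:
`g = [F:ℚ]/2 ≥ 3`, `P = minpoly_ℤ(a₀)` of a separating integer of a Galois CM field `F` of degree `2g` (monic, irreducible,
no real root — `F` is totally complex —, complex conjugation induced by one `Q ∈ ℚ[T]`:
`AndreProductForm.minpoly_facts`, `Milne2020.isGaloisCMFieldPoly_minpoly`), `A = ⨁_j A_{(F, f.corner j)}` of dimension
`2[F:ℚ] = 4g` with `φ = act(a₀)`, `P(φ) = 0`.  In particular neither Markman's fourfold theorem (imaginary quadratic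
fields) nor the quartic CM fields nor any non-CM carrier of the item is needed for `HC_CM`.
[cite: Andre1992HodgeCM, Théorème] [cite: MoonenZarhin1998WeilClasses, §1] [cite: Pohlmann1968, Thm. 1]
[cite: Markman2025SurveySecant, Thm. 1.4 and §12] -/
theorem cmAbelianHodge_of_rankFourWeilClasses (h : RankFourWeilClasses) : CMAbelianHodge := by
  refine hc_cm_of_forall_face_weilClassesField exists_isReal_hodgeModel_holds hodgePQ_independent_of_hodgeModel_holds
    BallQuotient.ballQuotientUniformisedDatum_holds cmAbelianVarietyRealised_holds ?_
  intro F hG h6 f a₀ hsep w hw hwQ hwH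
  haveI : IsGalois ℚ (F : Type) := hG
  obtain ⟨hPm, hPirr, hPe, -, -⟩ := minpoly_facts (F : Type) a₀ hsep
  obtain ⟨-, -, -, -, hreal, hQ, -⟩ := isGaloisCMFieldPoly_minpoly (F : Type) a₀ hsep
  -- `[F:ℚ] = 2g` with `g ≥ 3`
  have hfin : Module.finrank ℚ F = 2 * (Module.finrank ℚ F / 2) := by
    have h1 := IsTotallyComplex.finrank (K := (F : Type))
    omega
  set g : ℕ := Module.finrank ℚ F / 2 with hg_def
  have hg : 2 ≤ g := by omega
  -- the corner product has dimension `4g`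
  have hdim : (⨁ cornerAV cmAbelianVarietyRealised_holds F f.corner).dim = 4 * g := by
    have hd := two_mul_dim_biproduct_cornerAV cmAbelianVarietyRealised_holds F f.corner
    omega
  have hsp : IsSmoothProjective (4 * g) (⨁ cornerAV cmAbelianVarietyRealised_holds F f.corner).X := by
    rw [← hdim]
    exact AbelianVariety.isSmoothProjective_holds
  refine h g hg (minpoly ℤ a₀) hPm (hPe.trans hfin) hPirr ?_ ?_ _ _ hdim hsp
    (eval₂_diagHom_minpoly F _ _ a₀) w hwQ ?_ hw
  · -- no real root
    intro ρ hρ him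
    exact hreal ρ hρ (Complex.conj_eq_iff_im.mpr him)
  · -- complex conjugation is a rational polynomial on the roots
    obtain ⟨Q, hQ⟩ := hQ
    exact ⟨Q, fun ρ hρ => by rw [Polynomial.aeval_def]; exact hQ ρ hρ⟩
  · -- Hodge type `(2,2)` read at dimension `4g`
    rw [← hdim]
    exact hwH

/-- **The crux `FaceReduction` (stmt-HodgeConjecture-16266, `RankFourWeilTransport → CMAbelianHodge`) follows from
the support item `RankFourWeilClasses` with the transport hypothesis IDLE** (cf. the conditional
`Ring2AbelianAllFrameRankFour.faceReduction_of_andre_of_hazama_of_markmanFourfolds_of_rankFourWeilClasses`, whose three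
records are not needed). [cite: Andre1992HodgeCM, Théorème] [cite: Pohlmann1968, Thm. 1] -/
theorem faceReduction_of_rankFourWeilClasses (h : RankFourWeilClasses) : FaceReduction := by
  unfold FaceReduction
  exact fun _ => cmAbelianHodge_of_rankFourWeilClasses h

/-- **`FaceReduction` ⟺ (`RankFourWeilTransport` ⟹ the face form)**: since `HC_CM` is equivalent to the face form
(`hc_cm_iff_forall_face_weilClassesField_of_record`), the crux is EXACTLY the statement that rank-four transport makes the
rational `(2,2)` classes of `W_F ⊗ ℂ` on the CM corner products of faces algebraic.
[cite: Pohlmann1968, Thm. 1] [cite: MoonenZarhin1998WeilClasses, §1] -/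
theorem faceReduction_iff_transport_imp_faceWeilClasses :
    FaceReduction ↔
      (RankFourWeilTransport → ∀ (F : CMField), IsGalois ℚ F → 6 ≤ Module.finrank ℚ F → ∀ (f : Face F) (a₀ : 𝓞 F),
        (Function.Injective fun σ : (F : Type) →+* ℂ => σ (a₀ : F)) →
        ∀ w ∈ weilClassesField (⨁ cornerAV cmAbelianVarietyRealised_holds F f.corner)
            (diagHom F (cornerAV cmAbelianVarietyRealised_holds F f.corner)
              (cornerAct cmAbelianVarietyRealised_holds F f.corner) a₀) (minpoly ℤ a₀) (2 * 2),
          IsRationalClass w →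
          IsOfHodgeType (⨁ cornerAV cmAbelianVarietyRealised_holds F f.corner).dim
            (⨁ cornerAV cmAbelianVarietyRealised_holds F f.corner).X (2 * 2) 2 2 w →
          w ∈ algebraicClasses (⨁ cornerAV cmAbelianVarietyRealised_holds F f.corner).X 2) := by
  unfold FaceReduction
  exact ⟨fun h hT => hc_cm_iff_forall_face_weilClassesField_of_record.1 (h hT),
    fun h hT => hc_cm_iff_forall_face_weilClassesField_of_record.2 (h hT)⟩

end Summit.HodgeConjecture.CorCM.RankFourWeil

end
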